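import Summits.AtomisticToContinuum.BoseEinsteinCondensation.Theorems.BoxLatticeFSumDCTParseval
import Summits.AtomisticToContinuum.BoseEinsteinCondensation.Theorems.BlockLatticeFSumDirichletFloor
import Summits.AtomisticToContinuum.BoseEinsteinCondensation.Theorems.BoxLatticeFSumKernels
import HarnessLib

/-!
# DCT Parseval for DIRICHLET trial states, in MC's own currency (`occupation`, not `cellOccupation`)
# (decomp-a2c · hand-1 g9; kernel (i) of MC = `BoxShellModeCounting`)

For a Dirichlet trial state `Ψ : TrialState N L` (support in the open box `⊆ cellN N L`) and a one-body mode `φ`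
supported in the cell `[0,L)³`, the plain occupation of MC's statement equals the cell occupation of the
kinematics kit: `occupation N φ Ψ.ψ = cellOccupation N L φ Ψ.ψ`.  Hence the DCT Parseval of
`BoxLatticeFSumDCTParseval` reads, for Dirichlet states and `N ≥ 1`,
`Σ_q occupation N (boxBlockWave L K q) Ψ.ψ = Σ_B occupation N (subMode (L/K) B) Ψ.ψ`
(`parseval_boxBlockWaves_trialState`), and `occupation N (boxBlockWave L K 0) Ψ.ψ = occupation N (constantMode L) Ψ.ψ`
(`occupation_boxBlockWave_zero`).  Also `pathDispersion K q = 0 ↔ q = 0` (`pathDispersion_pos_iff`), the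
membership test of the deep set in `BoxDeepInfraredEmptiness`.  No definitions, no `sorry`. [folklore]
-/

noncomputable section

open MeasureTheory Finset
open scoped BigOperators ENNReal

namespace Summit.AtomisticToContinuum.BoseEinsteinCondensation.Theorems.BoxLatticeFSum

open Literature.MathematicalPhysics.QuantumManyBody.BoseGas
open Summit.AtomisticToContinuum.BoseEinsteinCondensation.Theorems.BlockLatticeFSumDirichletFloor

/-- For a Dirichlet trial state and a mode supported in the cell, plain occupation = cell occupation.
[folklore] -/
theorem occupation_eq_cellOccupation_of_support {N : ℕ} {L : ℝ} (Ψ : TrialState N L) {φ : Space → ℂ}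
    (hφ : Function.support φ ⊆ cell L) :
    occupation N φ Ψ.ψ = cellOccupation N L φ Ψ.ψ := by
  rw [cellOccupation, indicator_cellN_trialState Ψ le_rfl, Set.indicator_eq_self.2 hφ]

/-- The sub-cell mode of side `L/K` is supported in the cell `[0,L)³`. [folklore] -/
theorem support_subMode_subset_cell {K : ℕ} {L : ℝ} (hK : 0 < K) (hL : 0 < L) (B : SubIdx K) :
    Function.support (subMode (L / (K : ℝ)) B) ⊆ cell L := by
  have hKr : (0 : ℝ) < K := by exact_mod_cast hK
  rw [subMode_eq_indicator]
  refine (Set.support_indicator_subset).trans ?_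
  have h := subCell_subset_cell (div_pos hL hKr) B
  rwa [mul_div_cancel₀ L hKr.ne'] at h

/-- The DCT block wave is supported in the cell `[0,L)³`. [folklore] -/
theorem support_boxBlockWave_subset_cell {K : ℕ} {L : ℝ} (hK : 0 < K) (hL : 0 < L) (q : SubIdx K) :
    Function.support (boxBlockWave L K q) ⊆ cell L := by
  intro x hx
  rw [Function.mem_support] at hx
  by_contra hxc
  apply hx
  unfold boxBlockWave
  refine Finset.sum_eq_zero fun B _ => ?_
  have hB : subMode (L / (K : ℝ)) B x = 0 := by
    by_contra h
    exact hxc (support_subMode_subset_cell hK hL B (Function.mem_support.2 h))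
  rw [hB, mul_zero]

/-- **DCT Parseval for Dirichlet trial states** (MC's currency): for `Ψ : TrialState N L`, `N ≥ 1`, `K > 0`,
`Σ_q occupation N (boxBlockWave L K q) Ψ.ψ = Σ_B occupation N (subMode (L/K) B) Ψ.ψ`. [folklore] -/
theorem parseval_boxBlockWaves_trialState {N : ℕ} {L : ℝ} {K : ℕ} (hN : 0 < N) (hK : 0 < K) (hL : 0 < L)
    (Ψ : TrialState N L) :
    ∑ q : SubIdx K, occupation N (boxBlockWave L K q) Ψ.ψ =
      ∑ B : SubIdx K, occupation N (subMode (L / (K : ℝ)) B) Ψ.ψ := by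
  obtain ⟨n, rfl⟩ := Nat.exists_eq_succ_of_ne_zero hN.ne'
  simp_rw [occupation_eq_cellOccupation_of_support Ψ (support_boxBlockWave_subset_cell hK hL _),
    occupation_eq_cellOccupation_of_support Ψ (support_subMode_subset_cell hK hL _)]
  exact parseval_boxBlockWaves hK Ψ.contDiff.continuous

/-- **The flat mode in MC's currency**: `occupation N (boxBlockWave L K 0) Ψ.ψ = occupation N (constantMode L) Ψ.ψ`
(in fact the modes are equal, `boxBlockWave_eq_constantMode_of_coords_zero`). [folklore] -/
theorem occupation_boxBlockWave_of_coords_zero {N : ℕ} {L : ℝ} {K : ℕ} (hK : 0 < K) (hL : 0 < L)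
    {q : SubIdx K} (hq : ∀ j : Fin 3, (q j : ℕ) = 0) (Ψ : Config N → ℂ) :
    occupation N (boxBlockWave L K q) Ψ = occupation N (constantMode L) Ψ := by
  rw [boxBlockWave_eq_constantMode_of_coords_zero hK hL hq]

/-- `pathDispersion K q > 0 ↔ q ≠ 0` (each term `1 − cos(π q_j/K)` vanishes iff `q_j = 0`, as
`0 ≤ π q_j/K < π`). [folklore] -/
theorem pathDispersion_pos_iff {K : ℕ} (hK : 0 < K) (q : SubIdx K) :
    0 < pathDispersion K q ↔ q ≠ fun _ => (⟨0, hK⟩ : Fin K) := by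
  have hKr : (0 : ℝ) < K := by exact_mod_cast hK
  have hterm : ∀ j : Fin 3, 0 ≤ 1 - Real.cos (Real.pi * ((q j : ℕ) : ℝ) / (K : ℝ)) :=
    fun j => by linarith [Real.cos_le_one (Real.pi * ((q j : ℕ) : ℝ) / (K : ℝ))]
  have hzero : ∀ j : Fin 3, 1 - Real.cos (Real.pi * ((q j : ℕ) : ℝ) / (K : ℝ)) = 0 ↔ (q j : ℕ) = 0 := by
    intro j
    have hlt : ((q j : ℕ) : ℝ) < K := by exact_mod_cast (q j).isLt
    have h0 : 0 ≤ Real.pi * ((q j : ℕ) : ℝ) / (K : ℝ) := by positivity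
    have h1 : Real.pi * ((q j : ℕ) : ℝ) / (K : ℝ) < Real.pi := by
      rw [div_lt_iff₀ hKr]; nlinarith [Real.pi_pos]
    constructor
    · intro h
      have hc : Real.cos (Real.pi * ((q j : ℕ) : ℝ) / (K : ℝ)) = 1 := by linarith
      have hx := (Real.cos_eq_one_iff_of_lt_of_lt (by linarith [Real.pi_pos]) (by linarith)).1 hc
      have : ((q j : ℕ) : ℝ) = 0 := by
        have hπ : Real.pi ≠ 0 := Real.pi_pos.ne'
        field_simp at hx
        simpa [hπ] using hx
      exact_mod_cast this
    · intro h; rw [h]; simp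
  unfold pathDispersion
  constructor
  · intro hpos heq
    subst heq
    simp at hpos
  · intro hne
    obtain ⟨j, hj⟩ : ∃ j, (q j : ℕ) ≠ 0 := by
      by_contra hcon
      push Not at hcon
      exact hne (funext fun j => Fin.ext (hcon j))
    have hjpos : 0 < 1 - Real.cos (Real.pi * ((q j : ℕ) : ℝ) / (K : ℝ)) :=
      lt_of_le_of_ne (hterm j) (fun h => hj ((hzero j).1 h.symm))
    calc (0 : ℝ) < 1 - Real.cos (Real.pi * ((q j : ℕ) : ℝ) / (K : ℝ)) := hjpos
      _ ≤ ∑ i : Fin 3, (1 - Real.cos (Real.pi * ((q i : ℕ) : ℝ) / (K : ℝ))) :=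
          Finset.single_le_sum (f := fun i => 1 - Real.cos (Real.pi * ((q i : ℕ) : ℝ) / (K : ℝ)))
            (fun i _ => hterm i) (Finset.mem_univ j)

end Summit.AtomisticToContinuum.BoseEinsteinCondensation.Theorems.BoxLatticeFSum

end
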